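import Summits.QuantumFields.YangMills.Theorems.UnitScaleTiltProp7CombAccFrameMassStep
import Summits.QuantumFields.YangMills.Theorems.UnitScaleTiltProp7FrameRem2Step
import HarnessLib

/-!
# Route `UnitScaleTilt`, crux K1 «MinimiserStabilityRegPr» (stmt-QuantumFields-19200), route-R E′ (A′)-on-Σ, P-A2 (β), R0 ∕ REM2ᶜ — file F-αᶜ:
# **THE ONE-STEP INEQUALITY FOR PRINT's COMB ACCUMULATED FRAMES AT SECOND ORDER, IN `ℓ¹` OVER ONE PERIOD CELL** (generic level `l`, every input displayed):
# `Ψᶜ_{l+1} ≤ (Lᵈ)⁻¹·Ψᶜ_l + Σ_z (Lᵈ)⁻¹Σ_r SR_r(z) + 13·C_R²·Σ_z B(z) + 49·Φᶜ_l` — the `ℤᵈ`∕`vcov`∕`treeWord` twin of ✓px13 `Prop7FrameRem2Step.frameRem2_step_le`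

Cell `ym3-torus` (HUMAN RULING D-0037: YM₃ on the torus is ladder rung R3 — not d = 4, not a mass gap, not Clay), width seat `ym3-torus-px17` (gen 4); ★★OWNER RULINGS №19 (3) (R0-RECURSION) ∕ №20 (1)
(«REM2ᶜ ⟸ `hMcomb₂`»; (R0) ⟸ Φᶜ + Φˢ + REM2ˢ + REM2ᶜ by ✓px13 `Prop7R0OfFrameRows`).  px13 g6's LOCATE #57 §3: «F-α applies VERBATIM to print's comb tower … its `S_k` needs comb LINK second-order
remainders»; F-α (✓p701000) is typed on the TORUS tower (`frameAccU`, `stairWord`, `Idx`), so the comb half needs THIS twin on lit's `ℤᵈ` letters — exactly as ★routeR-w6 g8's F2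
✓`Prop7CombAccFrameMassStep.combFrameMass_step_le` is the twin of ✓px22 `frameMass_step_le` at first order.  `--supports stmt-QuantumFields-19200 --as helper`; THEOREMS ONLY (0 `def`, 0 `sorry`);
count-neutral.  Nothing of REM2ᶜ's currency, `hMcomb`, `hMcomb₂`, (β), `hPA2`, `hcoS`, E′, EX, the crux, d = 4 or the gap is claimed.

THE PRINT.  [Balaban1985Averaging] (82) p. 30 (block frame `exp[mean log]` of the twisted tree transports), (97) p. 32 (`v_{j+1}(z) = v_j(Lz)·w_j(Lz)`), (92) p. 31, (26)–(27) p. 22 (log∕exp of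
near-unit products to second order); [Balaban1987RG1] (0.3)–(0.4) pp. 252–253 (blocks, block means).

LETTERS (★routeR-w6 F1 ✓`Prop7CombAccFrameStep`, level `l`, coarse label `ẑ`, box offsets `r : Fin d → Fin L`, box point `L•ẑ + r = (blockSite z r)^`): `v_l = vcov L U₀ U₁ l`,
`ν_r(z) = Ū₀ˡ(Γ_r)` = `hol (avgIter L U₀ l) (L•ẑ) (treeWord r)` (BACKGROUND tree transport — no linear part), `R_r(z) = tHol (avgIter L U₀ l) (tildIter L U₀ U₁ l) (L•ẑ) (treeWord r)`
(single-bar tree ratio of print's comb tower), `a_r(z) = ν_r·v_l(L•ẑ + r)·ν_r⁻¹`, `v_{l+1}(ẑ) = v_l(L•ẑ)·eml_r(v_l(L•ẑ)⁻¹R_r a_r)` (✓`coe_vcov_succ_eq`).  «LINEAR PARTS» are ABSTRACT: `ℓ_l` on the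
labels for the frames, `ℓR` for the tree ratios; the new frame's is **`ℓ_{l+1}(z) := (Lᵈ)⁻¹Σ_r (ℓR z r + ν_r·ℓ_l(L•ẑ + r)·ν_r⁻¹)`** (its identification with `fderiv` is ★routeR-w2 g9's R0-LIN comb half).

WHAT IS PROVED (ns `…Theorems.Prop7CombFrameRem2Step`; generic complete normed ℂ-algebra `𝔸`, any `P : Params`).
* §1 ★★ `norm_vcov_succ_sub_one_sub_lin_le` — POINTWISE on `ℤᵈ`: `‖v_{l+1}(ẑ) − 1 − ℓ_{l+1}(z)‖ ≤ (Lᵈ)⁻¹Σ_r (‖R_r − 1 − ℓR r‖ + ‖v_l(L•ẑ+r) − 1 − ℓ_l(L•ẑ+r)‖ + ‖R_r − 1‖·‖a_r − 1‖) + 6t²`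
  (✓px13 `norm_mul_eml_sub_one_sub_mean_le_split` ∘ ✓routeR-w6 `coe_vcov_succ_eq` ∘ ✓px13 `norm_conj_sub_one_sub_le`).
* §2 ★★★ `combFrameRem2_step_le` — IN `ℓ¹` over the period cell, under ✓`combFrameMass_step_le`'s displayed rows VERBATIM (bi-contractivity of `ν_r`, `v_l`; frame sup `δ₂`; tree-ratio row
  `C_R√B`; `t* = ρ + 3δ₂ ≤ ¼`) plus abstract remainder majorants `hE : ‖v_l(x̂) − 1 − ℓ_l(x̂)‖ ≤ E x`, `hSR : ‖R_r(z) − 1 − ℓR z r‖ ≤ SR z r`: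
  `Σ_z ‖v_{l+1}(ẑ) − 1 − ℓ_{l+1}(z)‖ ≤ (Lᵈ)⁻¹·Σ_x E x + Σ_z (Lᵈ)⁻¹Σ_r SR z r + 13·C_R²·Σ_z B z + 49·Σ_x ‖v_l(x̂) − 1‖²` — THE DAMPING `(Lᵈ)⁻¹` IS FREE (the centre frame cancels exactly).
HONEST SCOPE.  Algebra + real bookkeeping over px13's abstract rows and routeR-w6's letters; no smallness produced; the tree remainder row `SR` (⟸ `hMcomb₂`) and the T³ currencies are F-βᶜ∕F-γᶜ.

References: T. Bałaban, CMP **98** (1985) 17–51 [Balaban1985Averaging] ((26)–(27) p.22, (58) p.27, (82) p.30, (92) p.31, (97) p.32); CMP **109** (1987) 249–301 [Balaban1987RG1] ((0.3)–(0.4) pp.252–253).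
-/

set_option autoImplicit false

noncomputable section

open scoped BigOperators

namespace Summit.QuantumFields.YangMills.Theorems.Prop7CombFrameRem2Step

open Finset NormedSpace
open Literature.MathematicalPhysics.QuantumFieldTheory.Balaban1983to89
open T4Continuum BlockAveraging
open ExpMeanLog (eml)
open B7Prop1Explicit (hol treeWord boxVec disp_treeWord)
open B7Prop2Explicit (avgIter)
open B7Eq92Concrete (Rc Rc_apply tHol tildIter dbavgCovIter vcov)
open Summit.QuantumFields.YangMills.Theorems.LinearLiftGauge (sum_blockSite_eq)
open Summit.QuantumFields.YangMills.Theorems.Prop7BlockMeanContraction (sum_sum_block_eq)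
open Summit.QuantumFields.YangMills.Theorems.Prop7AccumulatedFrameStep (norm_inv_mul_sub_one_le)
open Summit.QuantumFields.YangMills.Theorems.Prop7FrameMassStep (norm_conj_sub_one_le norm_conj_le_one)
open Summit.QuantumFields.YangMills.Theorems.Prop7CombAccFrameStep (tHol_dbavgCovIter_eq_frame_inv_mul coe_vcov_succ_eq)
open Summit.QuantumFields.YangMills.Theorems.Prop7CombAccFrameMassStep (valLift_blockSite sum_blockLift_eq sum_sq_blockMeanLift_le le_sqrt_sum_sq)
open Summit.QuantumFields.YangMills.Theorems.Prop7FrameRem2Step (norm_mul_eml_sub_one_sub_mean_le_split norm_conj_sub_one_sub_le)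
open B11Eq98V0LettersFlat (norm_inv_sub_one_le)

/-! ## §1 The pointwise second-order step on `ℤᵈ` -/

section Pointwise

variable {d : ℕ} {𝔸 : Type*} [NormedRing 𝔸] [NormedAlgebra ℂ 𝔸] [CompleteSpace 𝔸]

/-- ★★ **THE ONE-STEP COMB ACCUMULATED-FRAME INEQUALITY AT SECOND ORDER, POINTWISE** (twin of ✓`Prop7FrameRem2Step.norm_frameAccU_succ_sub_one_sub_lin_le` for print's (97)): with
`‖v_l(L•z)‖ ≤ 1`, the background tree transports `ν_r` bi-contractive, every twisted tree transport of the double-bar tower within `t ≤ ¼` of `1`, and ABSTRACT linear parts `ℓ_l` (frames, on the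
labels) and `ℓR` (tree ratios):
`‖v_{l+1}(z) − 1 − (Lᵈ)⁻¹Σ_r (ℓR r + ν_r·ℓ_l(L•z + r)·ν_r⁻¹)‖ ≤ (Lᵈ)⁻¹Σ_r (‖R_r − 1 − ℓR r‖ + ‖v_l(L•z + r) − 1 − ℓ_l(L•z + r)‖ + ‖R_r − 1‖·‖a_r − 1‖) + 6t²`.
[cite: Balaban1985Averaging, (82) p.30, (97) p.32, (26)-(27) p.22] -/
theorem norm_vcov_succ_sub_one_sub_lin_le {L : ℕ} (hL : 0 < L) (U₀ U₁ : (Fin d → ℤ) → Fin d → 𝔸ˣ) (j : ℕ) (z : (Fin d → ℤ)) {t : ℝ}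
    (hv : ‖(vcov L U₀ U₁ j ((L : ℤ) • z) : 𝔸)‖ ≤ 1)
    (hhol : ∀ r : Fin d → Fin L, ‖((hol (avgIter L U₀ j) ((L : ℤ) • z) (treeWord (boxVec L r)) : 𝔸ˣ) : 𝔸)‖ ≤ 1 ∧
      ‖(((hol (avgIter L U₀ j) ((L : ℤ) • z) (treeWord (boxVec L r)))⁻¹ : 𝔸ˣ) : 𝔸)‖ ≤ 1)
    (ht : ∀ r : Fin d → Fin L, ‖((tHol (avgIter L U₀ j) (dbavgCovIter L U₀ U₁ j) ((L : ℤ) • z) (treeWord (boxVec L r)) : 𝔸ˣ) : 𝔸) - 1‖ ≤ t) (ht4 : t ≤ 1 / 4)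
    (ℓj : (Fin d → ℤ) → 𝔸) (ℓR : (Fin d → Fin L) → 𝔸) :
    ‖(vcov L U₀ U₁ (j + 1) z : 𝔸) - 1
        - ((Fintype.card (Fin d → Fin L) : ℂ))⁻¹ • ∑ r : Fin d → Fin L,
            (ℓR r + ((hol (avgIter L U₀ j) ((L : ℤ) • z) (treeWord (boxVec L r)) : 𝔸ˣ) : 𝔸) * ℓj ((L : ℤ) • z + boxVec L r)
              * (((hol (avgIter L U₀ j) ((L : ℤ) • z) (treeWord (boxVec L r)))⁻¹ : 𝔸ˣ) : 𝔸))‖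
      ≤ (Fintype.card (Fin d → Fin L) : ℝ)⁻¹ * ∑ r : Fin d → Fin L,
          (‖((tHol (avgIter L U₀ j) (tildIter L U₀ U₁ j) ((L : ℤ) • z) (treeWord (boxVec L r)) : 𝔸ˣ) : 𝔸) - 1 - ℓR r‖
            + ‖(vcov L U₀ U₁ j ((L : ℤ) • z + boxVec L r) : 𝔸) - 1 - ℓj ((L : ℤ) • z + boxVec L r)‖
            + ‖((tHol (avgIter L U₀ j) (tildIter L U₀ U₁ j) ((L : ℤ) • z) (treeWord (boxVec L r)) : 𝔸ˣ) : 𝔸) - 1‖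
              * ‖((Rc (hol (avgIter L U₀ j) ((L : ℤ) • z) (treeWord (boxVec L r))) (vcov L U₀ U₁ j ((L : ℤ) • z + boxVec L r)) : 𝔸ˣ) : 𝔸) - 1‖)
        + 6 * t ^ 2 := by
  haveI : Nonempty (Fin d → Fin L) := ⟨fun _ => ⟨0, hL⟩⟩
  have ht' : ∀ r : Fin d → Fin L, ‖(((vcov L U₀ U₁ j ((L : ℤ) • z))⁻¹ : 𝔸ˣ) : 𝔸)
        * ((((tHol (avgIter L U₀ j) (tildIter L U₀ U₁ j) ((L : ℤ) • z) (treeWord (boxVec L r)) : 𝔸ˣ) : 𝔸)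
          * ((Rc (hol (avgIter L U₀ j) ((L : ℤ) • z) (treeWord (boxVec L r))) (vcov L U₀ U₁ j ((L : ℤ) • z + boxVec L r)) : 𝔸ˣ) : 𝔸))) - 1‖ ≤ t := by
    intro r
    have h := ht r
    rwa [tHol_dbavgCovIter_eq_frame_inv_mul, disp_treeWord, Units.val_mul, Units.val_mul] at h
  rw [coe_vcov_succ_eq]
  refine (norm_mul_eml_sub_one_sub_mean_le_split (vcov L U₀ U₁ j ((L : ℤ) • z)) hv _ _ ℓR
    (fun r : Fin d → Fin L => ((hol (avgIter L U₀ j) ((L : ℤ) • z) (treeWord (boxVec L r)) : 𝔸ˣ) : 𝔸) * ℓj ((L : ℤ) • z + boxVec L r)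
      * (((hol (avgIter L U₀ j) ((L : ℤ) • z) (treeWord (boxVec L r)))⁻¹ : 𝔸ˣ) : 𝔸)) ht' ht4).trans (add_le_add ?_ le_rfl)
  refine mul_le_mul_of_nonneg_left (Finset.sum_le_sum fun r _ => ?_) (by positivity)
  -- the conjugated end frame: `a_r − 1 − ν_rℓ_l(x_r)ν_r⁻¹ = ν_r(v_l(x_r) − 1 − ℓ_l(x_r))ν_r⁻¹`
  have har : ‖((Rc (hol (avgIter L U₀ j) ((L : ℤ) • z) (treeWord (boxVec L r))) (vcov L U₀ U₁ j ((L : ℤ) • z + boxVec L r)) : 𝔸ˣ) : 𝔸) - 1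
        - ((hol (avgIter L U₀ j) ((L : ℤ) • z) (treeWord (boxVec L r)) : 𝔸ˣ) : 𝔸) * ℓj ((L : ℤ) • z + boxVec L r)
          * (((hol (avgIter L U₀ j) ((L : ℤ) • z) (treeWord (boxVec L r)))⁻¹ : 𝔸ˣ) : 𝔸)‖
      ≤ ‖(vcov L U₀ U₁ j ((L : ℤ) • z + boxVec L r) : 𝔸) - 1 - ℓj ((L : ℤ) • z + boxVec L r)‖ := by
    rw [Rc_apply, Units.val_mul, Units.val_mul]
    exact norm_conj_sub_one_sub_le _ _ _ (hhol r).1 (hhol r).2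
  linarith [har]

end Pointwise

/-! ## §2 ★★★ The `ℓ¹` step over the coarse sites of one period cell -/

section Step

variable {P : Params} {l : ℕ} {𝔸 : Type*} [NormedRing 𝔸] [NormedAlgebra ℂ 𝔸] [CompleteSpace 𝔸]

/-- the block mean of a function of the block sites, summed over the coarse sites, is `(Lᵈ)⁻¹·Σ_x` (✓`sum_blockSite_eq` + the block tiling ✓`sum_sum_block_eq`).
[cite: Balaban1987RG1, (0.3)-(0.4) pp.252-253] -/
theorem sum_blockMean_eq (hl : l + 1 ≤ P.m + P.K) (f : Site P l → ℝ) :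
    ∑ z : Site P (l + 1), ((P.L : ℝ) ^ P.d)⁻¹ * ∑ r : Fin P.d → Fin P.L, f (Site.blockSite z r) = ((P.L : ℝ) ^ P.d)⁻¹ * ∑ x : Site P l, f x := by
  rw [← Finset.mul_sum]
  refine congrArg (fun t : ℝ => ((P.L : ℝ) ^ P.d)⁻¹ * t) ?_
  calc ∑ z : Site P (l + 1), ∑ r : Fin P.d → Fin P.L, f (Site.blockSite z r)
      = ∑ z : Site P (l + 1), ∑ x ∈ block z, f x := Finset.sum_congr rfl fun z _ => sum_blockSite_eq hl z f
    _ = ∑ x : Site P l, f x := sum_sum_block_eq _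

set_option maxHeartbeats 400000 in
/-- ★★★ **THE ONE-STEP COMB ACCUMULATED-FRAME INEQUALITY AT SECOND ORDER, IN `ℓ¹` OVER ONE PERIOD CELL** (see the module docstring): under ✓`combFrameMass_step_le`'s displayed
bi-contractivity∕sup∕tree-ratio rows and window `t* := ρ + 3δ₂ ≤ ¼`, with abstract linear parts `ℓ_l` (on the labels), `ℓR` and their displayed remainder majorants `E`, `SR`:
`Σ_z ‖v_{l+1}(ẑ) − 1 − ℓ_{l+1}(z)‖ ≤ (Lᵈ)⁻¹·Σ_x E x + Σ_z (Lᵈ)⁻¹Σ_r SR z r + 13·C_R²·Σ_z B z + 49·Σ_x ‖v_l(x̂) − 1‖²`.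
[cite: Balaban1985Averaging, (82) p.30, (97) p.32, Prop. 3 (122)-(126) p.36; Balaban1987RG1, (0.3)-(0.4) pp.252-253] -/
theorem combFrameRem2_step_le (hl : l + 1 ≤ P.m + P.K) (U₀ U₁ : (Fin P.d → ℤ) → Fin P.d → 𝔸ˣ) {δ₂ ρ CR : ℝ} (B : Site P (l + 1) → ℝ)
    (hCR : 0 ≤ CR) (hB0 : ∀ z, 0 ≤ B z) (hδ₂ : 0 ≤ δ₂) (hρ : 0 ≤ ρ)
    (hhol : ∀ (z : Site P (l + 1)) (r : Fin P.d → Fin P.L),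
      ‖((hol (avgIter P.L U₀ l) ((P.L : ℤ) • (fun μ => ((z μ).val : ℤ))) (treeWord (boxVec P.L r)) : 𝔸ˣ) : 𝔸)‖ ≤ 1 ∧
        ‖(((hol (avgIter P.L U₀ l) ((P.L : ℤ) • (fun μ => ((z μ).val : ℤ))) (treeWord (boxVec P.L r)))⁻¹ : 𝔸ˣ) : 𝔸)‖ ≤ 1)
    (hv1 : ∀ x : Site P l, ‖(vcov P.L U₀ U₁ l (fun μ => ((x μ).val : ℤ)) : 𝔸)‖ ≤ 1)
    (hv1' : ∀ x : Site P l, ‖(((vcov P.L U₀ U₁ l (fun μ => ((x μ).val : ℤ)))⁻¹ : 𝔸ˣ) : 𝔸)‖ ≤ 1)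
    (hv2 : ∀ x : Site P l, ‖(vcov P.L U₀ U₁ l (fun μ => ((x μ).val : ℤ)) : 𝔸) - 1‖ ≤ δ₂)
    (hR : ∀ (z : Site P (l + 1)) (r : Fin P.d → Fin P.L),
      ‖((tHol (avgIter P.L U₀ l) (tildIter P.L U₀ U₁ l) ((P.L : ℤ) • (fun μ => ((z μ).val : ℤ))) (treeWord (boxVec P.L r)) : 𝔸ˣ) : 𝔸) - 1‖ ≤ CR * Real.sqrt (B z))
    (hρB : ∀ z, CR * Real.sqrt (B z) ≤ ρ) (ht : ρ + 3 * δ₂ ≤ 1 / 4)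
    (ℓl : (Fin P.d → ℤ) → 𝔸) (E : Site P l → ℝ) (hE : ∀ x : Site P l, ‖(vcov P.L U₀ U₁ l (fun μ => ((x μ).val : ℤ)) : 𝔸) - 1 - ℓl (fun μ => ((x μ).val : ℤ))‖ ≤ E x)
    (ℓR : Site P (l + 1) → (Fin P.d → Fin P.L) → 𝔸) (SR : Site P (l + 1) → (Fin P.d → Fin P.L) → ℝ)
    (hSR : ∀ (z : Site P (l + 1)) (r : Fin P.d → Fin P.L),
      ‖((tHol (avgIter P.L U₀ l) (tildIter P.L U₀ U₁ l) ((P.L : ℤ) • (fun μ => ((z μ).val : ℤ))) (treeWord (boxVec P.L r)) : 𝔸ˣ) : 𝔸) - 1 - ℓR z r‖ ≤ SR z r) :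
    ∑ z : Site P (l + 1), ‖(vcov P.L U₀ U₁ (l + 1) (fun μ => ((z μ).val : ℤ)) : 𝔸) - 1
        - ((Fintype.card (Fin P.d → Fin P.L) : ℂ))⁻¹ • ∑ r : Fin P.d → Fin P.L,
            (ℓR z r + ((hol (avgIter P.L U₀ l) ((P.L : ℤ) • (fun μ => ((z μ).val : ℤ))) (treeWord (boxVec P.L r)) : 𝔸ˣ) : 𝔸)
              * ℓl ((P.L : ℤ) • (fun μ => ((z μ).val : ℤ)) + boxVec P.L r)
              * (((hol (avgIter P.L U₀ l) ((P.L : ℤ) • (fun μ => ((z μ).val : ℤ))) (treeWord (boxVec P.L r)))⁻¹ : 𝔸ˣ) : 𝔸))‖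
      ≤ ((P.L : ℝ) ^ P.d)⁻¹ * ∑ x : Site P l, E x
        + ∑ z : Site P (l + 1), ((P.L : ℝ) ^ P.d)⁻¹ * ∑ r : Fin P.d → Fin P.L, SR z r
        + 13 * CR ^ 2 * ∑ z : Site P (l + 1), B z
        + 49 * ∑ x : Site P l, ‖(vcov P.L U₀ U₁ l (fun μ => ((x μ).val : ℤ)) : 𝔸) - 1‖ ^ 2 := by
  have hLpos : 0 < P.L := P.L_pos
  have hLd : (0 : ℝ) < (P.L : ℝ) ^ P.d := pow_pos (Nat.cast_pos.2 hLpos) _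
  have ht0 : 0 ≤ ρ + 3 * δ₂ := by positivity
  have hcard : (Fintype.card (Fin P.d → Fin P.L) : ℝ) = (P.L : ℝ) ^ P.d := by
    rw [Fintype.card_fun, Fintype.card_fin, Fintype.card_fin]; push_cast; ring
  -- letters: the frame deviation on the labels
  set f : (Fin P.d → ℤ) → ℝ := fun x => ‖(vcov P.L U₀ U₁ l x : 𝔸) - 1‖ with hf
  have hf0 : ∀ x, 0 ≤ f x := fun x => norm_nonneg _
  -- the pointwise bound at every coarse site
  have hpt : ∀ z : Site P (l + 1), ‖(vcov P.L U₀ U₁ (l + 1) (fun μ => ((z μ).val : ℤ)) : 𝔸) - 1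
        - ((Fintype.card (Fin P.d → Fin P.L) : ℂ))⁻¹ • ∑ r : Fin P.d → Fin P.L,
            (ℓR z r + ((hol (avgIter P.L U₀ l) ((P.L : ℤ) • (fun μ => ((z μ).val : ℤ))) (treeWord (boxVec P.L r)) : 𝔸ˣ) : 𝔸)
              * ℓl ((P.L : ℤ) • (fun μ => ((z μ).val : ℤ)) + boxVec P.L r)
              * (((hol (avgIter P.L U₀ l) ((P.L : ℤ) • (fun μ => ((z μ).val : ℤ))) (treeWord (boxVec P.L r)))⁻¹ : 𝔸ˣ) : 𝔸))‖
      ≤ ((P.L : ℝ) ^ P.d)⁻¹ * ∑ r : Fin P.d → Fin P.L, SR z r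
        + ((P.L : ℝ) ^ P.d)⁻¹ * ∑ r : Fin P.d → Fin P.L, E (Site.blockSite z r)
        + (1 / 2 * (CR ^ 2 * B z) + 1 / 2 * (((P.L : ℝ) ^ P.d)⁻¹ * ∑ r : Fin P.d → Fin P.L, f (fun μ => (((Site.blockSite z r) μ).val : ℤ)) ^ 2))
        + (12 * (CR ^ 2 * B z) + 48 * ∑ r : Fin P.d → Fin P.L, f (fun μ => (((Site.blockSite z r) μ).val : ℤ)) ^ 2) := by
    intro z
    set zh : Fin P.d → ℤ := fun μ => ((z μ).val : ℤ) with hzh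
    have hbox : ∀ r : Fin P.d → Fin P.L, (P.L : ℤ) • zh + boxVec P.L r = fun μ => (((Site.blockSite z r) μ).val : ℤ) :=
      fun r => (valLift_blockSite hl z r).symm
    set V : ℝ := ∑ r : Fin P.d → Fin P.L, f (fun μ => (((Site.blockSite z r) μ).val : ℤ)) ^ 2 with hV
    have hV0 : 0 ≤ V := Finset.sum_nonneg fun _ _ => sq_nonneg _
    have hVr : ∀ r : Fin P.d → Fin P.L, f ((P.L : ℤ) • zh + boxVec P.L r) ≤ Real.sqrt V := by
      intro r
      rw [hbox r]
      exact le_sqrt_sum_sq (fun r' => f (fun μ => (((Site.blockSite z r') μ).val : ℤ))) (fun _ => hf0 _) r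
    have hcorner : (P.L : ℤ) • zh = fun μ => (((Site.blockSite z (fun _ => ⟨0, hLpos⟩)) μ).val : ℤ) := by
      rw [← hbox]; funext μ; simp [boxVec]
    have hv1c : ‖(vcov P.L U₀ U₁ l ((P.L : ℤ) • zh) : 𝔸)‖ ≤ 1 := by rw [hcorner]; exact hv1 _
    have hv1c' : ‖(((vcov P.L U₀ U₁ l ((P.L : ℤ) • zh))⁻¹ : 𝔸ˣ) : 𝔸)‖ ≤ 1 := by rw [hcorner]; exact hv1' _
    have hv1r : ∀ r : Fin P.d → Fin P.L, ‖(vcov P.L U₀ U₁ l ((P.L : ℤ) • zh + boxVec P.L r) : 𝔸)‖ ≤ 1 := fun r => by rw [hbox r]; exact hv1 _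
    have hv2r : ∀ r : Fin P.d → Fin P.L, ‖(vcov P.L U₀ U₁ l ((P.L : ℤ) • zh + boxVec P.L r) : 𝔸) - 1‖ ≤ δ₂ := fun r => by rw [hbox r]; exact hv2 _
    have hv2c : ‖(((vcov P.L U₀ U₁ l ((P.L : ℤ) • zh))⁻¹ : 𝔸ˣ) : 𝔸) - 1‖ ≤ f ((P.L : ℤ) • zh + boxVec P.L (fun _ => ⟨0, hLpos⟩)) := by
      have h0 : (P.L : ℤ) • zh + boxVec P.L (fun _ => ⟨0, hLpos⟩) = (P.L : ℤ) • zh := by funext μ; simp [boxVec]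
      rw [h0]
      exact norm_inv_sub_one_le _ hv1c'
    -- the end frames: conjugation by bi-contractive `ν_r`
    have ha1 : ∀ r : Fin P.d → Fin P.L, ‖((Rc (hol (avgIter P.L U₀ l) ((P.L : ℤ) • zh) (treeWord (boxVec P.L r))) (vcov P.L U₀ U₁ l ((P.L : ℤ) • zh + boxVec P.L r)) : 𝔸ˣ) : 𝔸) - 1‖
        ≤ ‖(vcov P.L U₀ U₁ l ((P.L : ℤ) • zh + boxVec P.L r) : 𝔸) - 1‖ := fun r => by
      rw [Rc_apply]; exact norm_conj_sub_one_le _ _ (hhol z r).1 (hhol z r).2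
    have ha0 : ∀ r : Fin P.d → Fin P.L, ‖((Rc (hol (avgIter P.L U₀ l) ((P.L : ℤ) • zh) (treeWord (boxVec P.L r))) (vcov P.L U₀ U₁ l ((P.L : ℤ) • zh + boxVec P.L r)) : 𝔸ˣ) : 𝔸)‖ ≤ 1 := fun r => by
      rw [Rc_apply]; exact norm_conj_le_one _ _ (hhol z r).1 (hhol z r).2 (hv1r r)
    -- the local sup letter `t_z ≤ min (t*, C_R√B + 2√V)`
    set tloc : ℝ := CR * Real.sqrt (B z) + 2 * Real.sqrt V with htloc
    set tz : ℝ := min (ρ + 3 * δ₂) tloc with htz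
    have htz_le : ∀ r : Fin P.d → Fin P.L,
        ‖((tHol (avgIter P.L U₀ l) (dbavgCovIter P.L U₀ U₁ l) ((P.L : ℤ) • zh) (treeWord (boxVec P.L r)) : 𝔸ˣ) : 𝔸) - 1‖ ≤ tz := by
      intro r
      rw [tHol_dbavgCovIter_eq_frame_inv_mul, disp_treeWord, Units.val_mul, Units.val_mul]
      have hRa : ‖((tHol (avgIter P.L U₀ l) (tildIter P.L U₀ U₁ l) ((P.L : ℤ) • zh) (treeWord (boxVec P.L r)) : 𝔸ˣ) : 𝔸)
            * ((Rc (hol (avgIter P.L U₀ l) ((P.L : ℤ) • zh) (treeWord (boxVec P.L r))) (vcov P.L U₀ U₁ l ((P.L : ℤ) • zh + boxVec P.L r)) : 𝔸ˣ) : 𝔸) - 1‖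
          ≤ ‖((tHol (avgIter P.L U₀ l) (tildIter P.L U₀ U₁ l) ((P.L : ℤ) • zh) (treeWord (boxVec P.L r)) : 𝔸ˣ) : 𝔸) - 1‖
            + ‖((Rc (hol (avgIter P.L U₀ l) ((P.L : ℤ) • zh) (treeWord (boxVec P.L r))) (vcov P.L U₀ U₁ l ((P.L : ℤ) • zh + boxVec P.L r)) : 𝔸ˣ) : 𝔸) - 1‖ := by
        set Rr := ((tHol (avgIter P.L U₀ l) (tildIter P.L U₀ U₁ l) ((P.L : ℤ) • zh) (treeWord (boxVec P.L r)) : 𝔸ˣ) : 𝔸)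
        set ar := ((Rc (hol (avgIter P.L U₀ l) ((P.L : ℤ) • zh) (treeWord (boxVec P.L r))) (vcov P.L U₀ U₁ l ((P.L : ℤ) • zh + boxVec P.L r)) : 𝔸ˣ) : 𝔸)
        have e : Rr * ar - 1 = (Rr - 1) * ar + (ar - 1) := by noncomm_ring
        rw [e]
        refine (norm_add_le _ _).trans (add_le_add ?_ le_rfl)
        exact (norm_mul_le _ _).trans (mul_le_of_le_one_right (norm_nonneg _) (ha0 r))
      have h3 := norm_inv_mul_sub_one_le (vcov P.L U₀ U₁ l ((P.L : ℤ) • zh)) hv1c'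
        (((tHol (avgIter P.L U₀ l) (tildIter P.L U₀ U₁ l) ((P.L : ℤ) • zh) (treeWord (boxVec P.L r)) : 𝔸ˣ) : 𝔸)
          * ((Rc (hol (avgIter P.L U₀ l) ((P.L : ℤ) • zh) (treeWord (boxVec P.L r))) (vcov P.L U₀ U₁ l ((P.L : ℤ) • zh + boxVec P.L r)) : 𝔸ˣ) : 𝔸))
      refine le_min ?_ ?_
      · calc _ ≤ (CR * Real.sqrt (B z) + δ₂) + δ₂ := h3.trans (add_le_add (hRa.trans (add_le_add (hR z r) ((ha1 r).trans (hv2r r))))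
              (hv2c.trans (hv2r _)))
          _ ≤ ρ + 3 * δ₂ := by linarith [hρB z]
      · calc _ ≤ (CR * Real.sqrt (B z) + Real.sqrt V) + Real.sqrt V := h3.trans (add_le_add (hRa.trans (add_le_add (hR z r) ((ha1 r).trans (hVr r))))
              (hv2c.trans (hVr _)))
          _ = tloc := by rw [htloc]; ring
    have htz4 : tz ≤ 1 / 4 := (min_le_left _ _).trans ht
    have htz0 : 0 ≤ tz := le_min ht0 (by positivity)
    -- §1 at the local sup letter
    have hB1 := norm_vcov_succ_sub_one_sub_lin_le hLpos U₀ U₁ l zh hv1c (hhol z) htz_le htz4 ℓl (ℓR z)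
    -- `6·t_z² ≤ 6·t_z·tloc ≤ …`; we use `t_z² ≤ tloc² ≤ 2(C_R²B + 4V)`
    have hquad : 6 * tz ^ 2 ≤ 12 * (CR ^ 2 * B z) + 48 * V := by
      have h1 : tz ^ 2 ≤ tloc ^ 2 := pow_le_pow_left₀ htz0 (min_le_right _ _) 2
      have e1 : (CR * Real.sqrt (B z)) ^ 2 = CR ^ 2 * B z := by rw [mul_pow, Real.sq_sqrt (hB0 z)]
      have e2 : (Real.sqrt V) ^ 2 = V := Real.sq_sqrt hV0
      have h2 : tloc ^ 2 ≤ 2 * ((CR * Real.sqrt (B z)) ^ 2 + (2 * Real.sqrt V) ^ 2) := by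
        rw [htloc]; nlinarith [sq_nonneg (CR * Real.sqrt (B z) - 2 * Real.sqrt V)]
      rw [e1, mul_pow, e2] at h2
      nlinarith [h1, h2]
    -- the mean of the three pointwise terms
    have hmean : (Fintype.card (Fin P.d → Fin P.L) : ℝ)⁻¹ * ∑ r : Fin P.d → Fin P.L,
          (‖((tHol (avgIter P.L U₀ l) (tildIter P.L U₀ U₁ l) ((P.L : ℤ) • zh) (treeWord (boxVec P.L r)) : 𝔸ˣ) : 𝔸) - 1 - ℓR z r‖
            + ‖(vcov P.L U₀ U₁ l ((P.L : ℤ) • zh + boxVec P.L r) : 𝔸) - 1 - ℓl ((P.L : ℤ) • zh + boxVec P.L r)‖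
            + ‖((tHol (avgIter P.L U₀ l) (tildIter P.L U₀ U₁ l) ((P.L : ℤ) • zh) (treeWord (boxVec P.L r)) : 𝔸ˣ) : 𝔸) - 1‖
              * ‖((Rc (hol (avgIter P.L U₀ l) ((P.L : ℤ) • zh) (treeWord (boxVec P.L r))) (vcov P.L U₀ U₁ l ((P.L : ℤ) • zh + boxVec P.L r)) : 𝔸ˣ) : 𝔸) - 1‖)
        ≤ ((P.L : ℝ) ^ P.d)⁻¹ * ∑ r : Fin P.d → Fin P.L, SR z r
          + ((P.L : ℝ) ^ P.d)⁻¹ * ∑ r : Fin P.d → Fin P.L, E (Site.blockSite z r)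
          + (1 / 2 * (CR ^ 2 * B z) + 1 / 2 * (((P.L : ℝ) ^ P.d)⁻¹ * ∑ r : Fin P.d → Fin P.L, f (fun μ => (((Site.blockSite z r) μ).val : ℤ)) ^ 2)) := by
      rw [hcard, Finset.sum_add_distrib, Finset.sum_add_distrib, mul_add, mul_add]
      refine add_le_add (add_le_add ?_ ?_) ?_
      · exact mul_le_mul_of_nonneg_left (Finset.sum_le_sum fun r _ => hSR z r) (by positivity)
      · refine mul_le_mul_of_nonneg_left (Finset.sum_le_sum fun r _ => ?_) (by positivity)
        have h := hE (Site.blockSite z r)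
        rwa [← hbox r] at h
      · -- AM–GM on the cross term: `‖R−1‖‖a−1‖ ≤ ½(C_R√B)² + ½‖v_l(x_r) − 1‖²`
        have hx : ∀ r : Fin P.d → Fin P.L,
            ‖((tHol (avgIter P.L U₀ l) (tildIter P.L U₀ U₁ l) ((P.L : ℤ) • zh) (treeWord (boxVec P.L r)) : 𝔸ˣ) : 𝔸) - 1‖
              * ‖((Rc (hol (avgIter P.L U₀ l) ((P.L : ℤ) • zh) (treeWord (boxVec P.L r))) (vcov P.L U₀ U₁ l ((P.L : ℤ) • zh + boxVec P.L r)) : 𝔸ˣ) : 𝔸) - 1‖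
            ≤ 1 / 2 * (CR ^ 2 * B z) + 1 / 2 * f (fun μ => (((Site.blockSite z r) μ).val : ℤ)) ^ 2 := by
          intro r
          have h1 := hR z r
          have h2 : ‖((Rc (hol (avgIter P.L U₀ l) ((P.L : ℤ) • zh) (treeWord (boxVec P.L r))) (vcov P.L U₀ U₁ l ((P.L : ℤ) • zh + boxVec P.L r)) : 𝔸ˣ) : 𝔸) - 1‖
              ≤ f (fun μ => (((Site.blockSite z r) μ).val : ℤ)) := by rw [← hbox r]; exact ha1 r
          have hsq : (CR * Real.sqrt (B z)) ^ 2 = CR ^ 2 * B z := by rw [mul_pow, Real.sq_sqrt (hB0 z)]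
          have h0a : 0 ≤ ‖((tHol (avgIter P.L U₀ l) (tildIter P.L U₀ U₁ l) ((P.L : ℤ) • zh) (treeWord (boxVec P.L r)) : 𝔸ˣ) : 𝔸) - 1‖ := norm_nonneg _
          have h0b : 0 ≤ ‖((Rc (hol (avgIter P.L U₀ l) ((P.L : ℤ) • zh) (treeWord (boxVec P.L r))) (vcov P.L U₀ U₁ l ((P.L : ℤ) • zh + boxVec P.L r)) : 𝔸ˣ) : 𝔸) - 1‖ :=
            norm_nonneg _
          nlinarith [mul_le_mul h1 h2 h0b ((norm_nonneg _).trans h1), hsq,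
            sq_nonneg (CR * Real.sqrt (B z) - f (fun μ => (((Site.blockSite z r) μ).val : ℤ)))]
        calc ((P.L : ℝ) ^ P.d)⁻¹ * ∑ r : Fin P.d → Fin P.L,
              ‖((tHol (avgIter P.L U₀ l) (tildIter P.L U₀ U₁ l) ((P.L : ℤ) • zh) (treeWord (boxVec P.L r)) : 𝔸ˣ) : 𝔸) - 1‖
                * ‖((Rc (hol (avgIter P.L U₀ l) ((P.L : ℤ) • zh) (treeWord (boxVec P.L r))) (vcov P.L U₀ U₁ l ((P.L : ℤ) • zh + boxVec P.L r)) : 𝔸ˣ) : 𝔸) - 1‖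
            ≤ ((P.L : ℝ) ^ P.d)⁻¹ * ∑ r : Fin P.d → Fin P.L, (1 / 2 * (CR ^ 2 * B z) + 1 / 2 * f (fun μ => (((Site.blockSite z r) μ).val : ℤ)) ^ 2) :=
              mul_le_mul_of_nonneg_left (Finset.sum_le_sum fun r _ => hx r) (by positivity)
          _ = 1 / 2 * (CR ^ 2 * B z) + 1 / 2 * (((P.L : ℝ) ^ P.d)⁻¹ * ∑ r : Fin P.d → Fin P.L, f (fun μ => (((Site.blockSite z r) μ).val : ℤ)) ^ 2) := by
              rw [Finset.sum_add_distrib, Finset.sum_const, Finset.card_univ, nsmul_eq_mul, hcard, mul_add, ← Finset.mul_sum]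
              have hc : ((P.L : ℝ) ^ P.d)⁻¹ * ((P.L : ℝ) ^ P.d * (1 / 2 * (CR ^ 2 * B z))) = 1 / 2 * (CR ^ 2 * B z) := by
                rw [← mul_assoc, inv_mul_cancel₀ hLd.ne', one_mul]
              rw [hc]
              ring
    linarith [hB1, hmean, hquad]
  refine (Finset.sum_le_sum fun z _ => hpt z).trans ?_
  simp only [Finset.sum_add_distrib]
  -- the `ℓ¹` letters
  have hE1 := sum_blockMean_eq hl E
  have hF1 : ∑ z : Site P (l + 1), ((P.L : ℝ) ^ P.d)⁻¹ * ∑ r : Fin P.d → Fin P.L, f (fun μ => (((Site.blockSite z r) μ).val : ℤ)) ^ 2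
      = ((P.L : ℝ) ^ P.d)⁻¹ * ∑ x : Site P l, f (fun μ => ((x μ).val : ℤ)) ^ 2 := by
    rw [← Finset.mul_sum, sum_blockLift_eq hl (fun x => f x ^ 2)]
  have h3 : ∑ z : Site P (l + 1), ∑ r : Fin P.d → Fin P.L, f (fun μ => (((Site.blockSite z r) μ).val : ℤ)) ^ 2 = ∑ x : Site P l, f (fun μ => ((x μ).val : ℤ)) ^ 2 :=
    sum_blockLift_eq hl (fun x => f x ^ 2)
  have hΦ0 : 0 ≤ ∑ x : Site P l, f (fun μ => ((x μ).val : ℤ)) ^ 2 := Finset.sum_nonneg fun x _ => sq_nonneg _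
  have hLd1 : ((P.L : ℝ) ^ P.d)⁻¹ ≤ 1 := by
    have h1 : (1 : ℝ) ≤ (P.L : ℝ) ^ P.d := one_le_pow₀ (by exact_mod_cast hLpos)
    exact inv_le_one_of_one_le₀ h1
  have s1a : ∑ z : Site P (l + 1), 1 / 2 * (CR ^ 2 * B z) = 1 / 2 * (CR ^ 2 * ∑ z : Site P (l + 1), B z) := by
    rw [← Finset.mul_sum, ← Finset.mul_sum]
  have s1b : ∑ z : Site P (l + 1), 1 / 2 * (((P.L : ℝ) ^ P.d)⁻¹ * ∑ r : Fin P.d → Fin P.L, f (fun μ => (((Site.blockSite z r) μ).val : ℤ)) ^ 2)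
      = 1 / 2 * (((P.L : ℝ) ^ P.d)⁻¹ * ∑ x : Site P l, f (fun μ => ((x μ).val : ℤ)) ^ 2) := by
    rw [← Finset.mul_sum, hF1]
  have s2a : ∑ z : Site P (l + 1), 12 * (CR ^ 2 * B z) = 12 * (CR ^ 2 * ∑ z : Site P (l + 1), B z) := by
    rw [← Finset.mul_sum, ← Finset.mul_sum]
  have s2b : ∑ z : Site P (l + 1), 48 * ∑ r : Fin P.d → Fin P.L, f (fun μ => (((Site.blockSite z r) μ).val : ℤ)) ^ 2 = 48 * ∑ x : Site P l, f (fun μ => ((x μ).val : ℤ)) ^ 2 := by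
    rw [← Finset.mul_sum, h3]
  have hLdΦ : ((P.L : ℝ) ^ P.d)⁻¹ * ∑ x : Site P l, f (fun μ => ((x μ).val : ℤ)) ^ 2 ≤ ∑ x : Site P l, f (fun μ => ((x μ).val : ℤ)) ^ 2 := by
    have := mul_le_mul_of_nonneg_right hLd1 hΦ0
    rwa [one_mul] at this
  have hB : 0 ≤ CR ^ 2 * ∑ z : Site P (l + 1), B z := mul_nonneg (sq_nonneg _) (Finset.sum_nonneg fun z _ => hB0 z)
  rw [hf] at s1b s2b hLdΦ hΦ0
  linarith [hE1, s1a, s1b, s2a, s2b, hLdΦ, hB, hΦ0]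

end Step

end Summit.QuantumFields.YangMills.Theorems.Prop7CombFrameRem2Step

end
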